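import Mathlib
import Summits.Ventures.HodgeRepro.Tier4.Target
import Summits.Ventures.HodgeRepro.Tier4.Line3.Defs
import Summits.Ventures.HodgeRepro.Tier4.Line3.LocaliserS
import Summits.Ventures.HodgeRepro.Tier4.Line3.Majorant
import Summits.Ventures.HodgeRepro.Tier4.Line3.OffMainOrbit
import Summits.Ventures.HodgeRepro.Tier4.Line3.SylvesterTransfer
import Summits.Ventures.HodgeRepro.Tier4.Line3.DefiniteBound
import Summits.Ventures.HodgeRepro.Tier4.Line3.KernelBound
import Summits.Ventures.HodgeRepro.Tier4.Line3.ClassBoundLemmas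

/-!
# Tier4/Line3/ClassBoundGauss — the Gaussian products and the uniform majorant of the class bound (part 1 of ClassBound): off the main orbit every summand is a uniform majorant times
`e^{−κ q^{N/d}}` (rung for L3.4 / L3.5)

Blind re-derivation cell `pub-hodge-repro`, Tier 4 «PROVE THE STEP» (README §9–§10), LINE L3 (Skeleton v0.24/v0.25,
`LocS` of `Tier4/Line3/LocaliserS.lean`), seat t4-L2-p3 on L3.5 `term_dominated` (lead S12234).

For a localiser `ℓ : LocS D 𝔭 L₀ xm` (two-sided integral `supp`, `growth` with the definite Gaussians `gaussDefAt c₀`) and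
the symmetric main tuple `xm` (`h02 h13 hab`), every line tuple `w` OFF the main orbit satisfies, at every depth `N` and
every `z ∈ 𝔹`,

  `‖summand D.Φ D.cf (ℓ.loc N) w z‖ ≤ B · majorantAt D.Φ e w z · C₁ · exp (−κ · (N(𝔭)^N)^{1/d})`

(`summand_bound_off_main`), with `majorantAt Φ e w z = (aNorm Φ z 0 + aNorm Φ z 1)⁴ · ∏_j (1 + ‖y_j‖)^e (Σ_i ‖y_j i‖)²
e^{−(π/2) maj(y_j, z)}` (`y_j = ballCoord (rep w j)`), INDEPENDENT of `N`, and constants `B, e` (from `growth`),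
`κ > 0`, `C₁` depending on `(X, D, ℓ, xm)` only.  Proof: `supp` gives a ball representative `x` of `w` and a lattice
`L ∈ S`; `OffMainOrbit.exists_gram_dev_size` gives a Gram entry `(i, j)` and an embedding `σ` with
`(N(𝔭)^N)^{1/d} ≤ ‖σ D₀‖ ‖σ α_ij‖`, `α = Gram(x) − Gram(xm)`; the chosen representative `rep w` differs from `x` by unit
scalars (`ClassBoundLemmas`), which change no norm, majorant or Gram-entry size; then EITHER `σ ∈ {τ₀, τ̄₀}` and the
kernel's half Gaussians at slots `i, j` are `≤ e^{−(π/2) R′}` (`gaussian_half_small` through the Sylvester transfer), OR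
`σ` is definite and the coefficient's definite Gaussians at slots `i, j` are `≤ e^{−c₀ R′ / (2K)}`
(`DefiniteBound.exp_mul_le_of_norm_ge`), where `R′ = (N(𝔭)^N)^{1/d}/D_max − G₀`; the kernel bound (`KernelBound`) and
`growth` supply the majorant, and `κ = min(π/2, c₀/(2K)) / D_max`, `C₁ = e^{κ D_max G₀}`.

Nothing here asserts anything about the truth of (P); HC_CM is NOT proved by anyone in this repository.
-/

set_option autoImplicit false

noncomputable section

namespace Summit.Ventures.HodgeRepro.Tier4.Line3

open Matrix NumberField
open scoped ComplexConjugate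

/-- A finite conditional product of Gaussians is at most `1`. -/
theorem finprod_cond_exp_le_one {ι : Type*} [Finite ι] (P : ι → Prop) (f : ι → ℝ) (hf : ∀ σ, 0 ≤ f σ) :
    (∏ᶠ (σ) (_ : P σ), Real.exp (-f σ)) ≤ 1 := by
  classical
  haveI := Fintype.ofFinite ι
  have hfin : (∏ᶠ (σ) (_ : P σ), Real.exp (-f σ)) = ∏ σ ∈ Finset.univ.filter P, Real.exp (-f σ) :=
    finprod_cond_eq_prod_of_cond_iff _ fun {σ} _ => by simp
  rw [hfin]
  refine Finset.prod_le_one (fun σ _ => (Real.exp_pos _).le) fun σ _ => ?_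
  rw [Real.exp_le_one_iff]
  linarith [hf σ]

/-- A finite conditional product of Gaussians is nonnegative. -/
theorem finprod_cond_exp_nonneg {ι : Type*} [Finite ι] (P : ι → Prop) (f : ι → ℝ) :
    0 ≤ (∏ᶠ (σ) (_ : P σ), Real.exp (-f σ)) := by
  classical
  haveI := Fintype.ofFinite ι
  have hfin : (∏ᶠ (σ) (_ : P σ), Real.exp (-f σ)) = ∏ σ ∈ Finset.univ.filter P, Real.exp (-f σ) :=
    finprod_cond_eq_prod_of_cond_iff _ fun {σ} _ => by simp
  rw [hfin]
  exact Finset.prod_nonneg fun σ _ => (Real.exp_pos _).le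

namespace T4Data

variable (X : T4Data)

/-- The definite Gaussian at one definite place bounds `gaussDefAt`. -/
theorem gaussDefAt_le_exp {c₀ : ℝ} (hc₀ : 0 ≤ c₀) (x : Fin 3 → X.E) (σ : X.E →+* ℂ)
    (hσ : σ ≠ X.τ₀ ∧ σ ≠ conjEmb X.τ₀) :
    X.gaussDefAt c₀ x ≤ Real.exp (-(c₀ * ∑ i, ‖σ (x i)‖ ^ 2)) := by
  unfold gaussDefAt
  exact finprod_cond_exp_le (fun σ : X.E →+* ℂ => σ ≠ X.τ₀ ∧ σ ≠ conjEmb X.τ₀)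
    (fun σ => c₀ * ∑ i, ‖σ (x i)‖ ^ 2)
    (fun σ => mul_nonneg hc₀ (Finset.sum_nonneg fun i _ => sq_nonneg _)) σ hσ

/-- `gaussDefAt ≤ 1`. -/
theorem gaussDefAt_le_one {c₀ : ℝ} (hc₀ : 0 ≤ c₀) (x : Fin 3 → X.E) : X.gaussDefAt c₀ x ≤ 1 := by
  unfold gaussDefAt
  exact finprod_cond_exp_le_one (fun σ : X.E →+* ℂ => σ ≠ X.τ₀ ∧ σ ≠ conjEmb X.τ₀)
    (fun σ => c₀ * ∑ i, ‖σ (x i)‖ ^ 2)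
    fun σ => mul_nonneg hc₀ (Finset.sum_nonneg fun i _ => sq_nonneg _)

/-- `0 ≤ gaussDefAt`. -/
theorem gaussDefAt_nonneg (c₀ : ℝ) (x : Fin 3 → X.E) : 0 ≤ X.gaussDefAt c₀ x := by
  unfold gaussDefAt
  exact finprod_cond_exp_nonneg (fun σ : X.E →+* ℂ => σ ≠ X.τ₀ ∧ σ ≠ conjEmb X.τ₀)
    (fun σ => c₀ * ∑ i, ‖σ (x i)‖ ^ 2)

/-- `gaussDefAt` is unchanged by a norm-one scalar. -/
theorem gaussDefAt_smul (c₀ : ℝ) {t : X.E} (ht : X.c t * t = 1) (x : Fin 3 → X.E) :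
    X.gaussDefAt c₀ (t • x) = X.gaussDefAt c₀ x := by
  unfold gaussDefAt
  congr 1
  funext σ
  congr 1
  funext _
  rw [X.sum_norm_emb_smul_eq σ ht]

/-- **THE UNIFORM MAJORANT** of the summand at the line tuple `w` and the point `z`: a polynomial prefactor times the
four HALF Gaussians of the majorant (the other halves, and the definite Gaussians, are spent on the decay in `N`). -/
def majorantAt (Φ : KMDatumS) (e : ℝ) (w : X.LineTuple) (z : Fin 2 → ℂ) : ℝ :=
  (aNorm Φ z 0 + aNorm Φ z 1) ^ 4 * ∏ j, ((1 + ‖X.ballCoord (X.rep w j)‖) ^ e *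
    ((∑ i, ‖X.ballCoord (X.rep w j) i‖) ^ 2 * Real.exp (-(Real.pi / 2) * maj (X.ballCoord (X.rep w j)) z)))

/-- `0 ≤ majorantAt`. -/
theorem majorantAt_nonneg (Φ : KMDatumS) (e : ℝ) (w : X.LineTuple) (z : Fin 2 → ℂ) :
    0 ≤ X.majorantAt Φ e w z := by
  unfold majorantAt
  refine mul_nonneg (pow_nonneg (add_nonneg (aNorm_nonneg _ _ _) (aNorm_nonneg _ _ _)) _) ?_
  exact Finset.prod_nonneg fun j _ => mul_nonneg (Real.rpow_nonneg (by positivity) _)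
    (mul_nonneg (sq_nonneg _) (Real.exp_pos _).le)

/-- The half-Gaussian product of a quadruple, with two slots `i, j` singled out: `∏_k e^{−(π/2) m_k} ≤ e^{−(π/2) R}`
whenever `R ≤ m_i + m_j` (`i ≠ j`) or `R ≤ m_i` (`i = j`), all `m_k ≥ 0`. -/
theorem prod_exp_half_le {m : Fin 4 → ℝ} (hm : ∀ k, 0 ≤ m k) (i j : Fin 4) (R : ℝ)
    (hR : (i ≠ j → R ≤ m i + m j) ∧ (i = j → R ≤ m i)) :
    ∏ k, Real.exp (-(Real.pi / 2) * m k) ≤ Real.exp (-(Real.pi / 2) * R) := by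
  have hpi : 0 < Real.pi := Real.pi_pos
  -- every factor is `≤ 1`, and the product is at most the product over `{i, j}`
  have hle1 : ∀ k, Real.exp (-(Real.pi / 2) * m k) ≤ 1 := fun k => by
    rw [Real.exp_le_one_iff]
    nlinarith [hm k]
  have hpos : ∀ k, 0 ≤ Real.exp (-(Real.pi / 2) * m k) := fun k => (Real.exp_pos _).le
  by_cases hij : i = j
  · subst hij
    have hRi := hR.2 rfl
    calc ∏ k, Real.exp (-(Real.pi / 2) * m k)
        ≤ Real.exp (-(Real.pi / 2) * m i) := by
          rw [← Finset.mul_prod_erase Finset.univ _ (Finset.mem_univ i)]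
          exact mul_le_of_le_one_right (hpos i) (Finset.prod_le_one (fun k _ => hpos k) fun k _ => hle1 k)
      _ ≤ Real.exp (-(Real.pi / 2) * R) := by
          apply Real.exp_le_exp.mpr
          nlinarith
  · have hRij := hR.1 hij
    have hj : j ∈ Finset.univ.erase i := Finset.mem_erase.mpr ⟨Ne.symm hij, Finset.mem_univ j⟩
    calc ∏ k, Real.exp (-(Real.pi / 2) * m k)
        = Real.exp (-(Real.pi / 2) * m i) * ∏ k ∈ Finset.univ.erase i, Real.exp (-(Real.pi / 2) * m k) :=
          (Finset.mul_prod_erase Finset.univ (fun k => Real.exp (-(Real.pi / 2) * m k)) (Finset.mem_univ i)).symm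
      _ = Real.exp (-(Real.pi / 2) * m i) * (Real.exp (-(Real.pi / 2) * m j) *
            ∏ k ∈ (Finset.univ.erase i).erase j, Real.exp (-(Real.pi / 2) * m k)) := by
          rw [Finset.mul_prod_erase (Finset.univ.erase i) (fun k => Real.exp (-(Real.pi / 2) * m k)) hj]
      _ ≤ Real.exp (-(Real.pi / 2) * m i) * (Real.exp (-(Real.pi / 2) * m j) * 1) := by
          refine mul_le_mul_of_nonneg_left (mul_le_mul_of_nonneg_left ?_ (hpos j)) (hpos i)
          exact Finset.prod_le_one (fun k _ => hpos k) fun k _ => hle1 k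
      _ = Real.exp (-(Real.pi / 2) * (m i + m j)) := by rw [mul_one, ← Real.exp_add]; ring_nf
      _ ≤ Real.exp (-(Real.pi / 2) * R) := by
          apply Real.exp_le_exp.mpr
          nlinarith

/-- The same for the definite Gaussians: `∏_k g_k ≤ e^{−c (S_i + S_j)}` (`i ≠ j`) resp. `≤ e^{−c S_i}` (`i = j`) when
`0 ≤ g_k ≤ 1` and `g_k ≤ e^{−c S_k}`. -/
theorem prod_le_exp_two {g S : Fin 4 → ℝ} {c : ℝ} (hg0 : ∀ k, 0 ≤ g k) (hg1 : ∀ k, g k ≤ 1)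
    (hgS : ∀ k, g k ≤ Real.exp (-(c * S k))) (i j : Fin 4) :
    ∏ k, g k ≤ (if i = j then Real.exp (-(c * S i)) else Real.exp (-(c * S i)) * Real.exp (-(c * S j))) := by
  by_cases hij : i = j
  · subst hij
    simp only [if_true]
    calc ∏ k, g k ≤ g i := by
          rw [← Finset.mul_prod_erase Finset.univ _ (Finset.mem_univ i)]
          exact mul_le_of_le_one_right (hg0 i) (Finset.prod_le_one (fun k _ => hg0 k) fun k _ => hg1 k)
      _ ≤ Real.exp (-(c * S i)) := hgS i
  · simp only [hij, if_false]
    have hj : j ∈ Finset.univ.erase i := Finset.mem_erase.mpr ⟨Ne.symm hij, Finset.mem_univ j⟩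
    calc ∏ k, g k = g i * ∏ k ∈ Finset.univ.erase i, g k :=
          (Finset.mul_prod_erase Finset.univ g (Finset.mem_univ i)).symm
      _ = g i * (g j * ∏ k ∈ (Finset.univ.erase i).erase j, g k) := by
          rw [Finset.mul_prod_erase (Finset.univ.erase i) g hj]
      _ ≤ g i * (g j * 1) := by
          refine mul_le_mul_of_nonneg_left (mul_le_mul_of_nonneg_left ?_ (hg0 j)) (hg0 i)
          exact Finset.prod_le_one (fun k _ => hg0 k) fun k _ => hg1 k
      _ ≤ Real.exp (-(c * S i)) * Real.exp (-(c * S j)) := by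
          rw [mul_one]
          exact mul_le_mul (hgS i) (hgS j) (hg0 j) (Real.exp_pos _).le

/-- `maj ≥ 0` on the ball (R2). -/
theorem maj_nonneg' (y : Fin 3 → ℂ) (z : Fin 2 → ℂ) (hz : z ∈ ball) : 0 ≤ maj y z :=
  (abs_nonneg _).trans (rung_abs_le_maj y z hz)

/-- The full Gaussian is the square of the half Gaussian. -/
theorem exp_neg_pi_eq_sq (m : ℝ) :
    Real.exp (-Real.pi * m) = Real.exp (-(Real.pi / 2) * m) * Real.exp (-(Real.pi / 2) * m) := by
  rw [← Real.exp_add]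
  ring_nf

/-- `conjIdeal` is `map cR`. -/
theorem conjIdeal_eq_map_cR (I : Ideal (RingOfIntegers X.E)) : X.conjIdeal I = Ideal.map X.cR I := rfl

/-- `‖conjEmb τ₀ t‖ = ‖τ₀ t‖`. -/
theorem norm_conjEmb_tau (t : X.E) : ‖conjEmb X.τ₀ t‖ = ‖X.τ₀ t‖ := by
  show ‖conj (X.τ₀ t)‖ = ‖X.τ₀ t‖
  exact Complex.norm_conj _

/-- The entry sum of `H` at any embedding is positive (`H ≠ 0` by anisotropy). -/
theorem sum_norm_emb_H_pos (σ : X.E →+* ℂ) : 0 < ∑ k, ∑ l, ‖σ (X.H k l)‖ := by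
  have hH : X.H ≠ 0 := by
    intro h0
    have := X.hAn' ![1, 0, 0] (by simp [hform, h0])
    have h1 := congrFun this 0
    simp at h1
  obtain ⟨k, l, hkl⟩ : ∃ k l, X.H k l ≠ 0 := by
    by_contra hall
    simp only [not_exists, not_not] at hall
    exact hH (Matrix.ext fun k l => hall k l)
  have hpos : 0 < ‖σ (X.H k l)‖ := norm_pos_iff.mpr ((map_ne_zero σ).mpr hkl)
  calc (0 : ℝ) < ‖σ (X.H k l)‖ := hpos
    _ ≤ ∑ l, ‖σ (X.H k l)‖ :=
        Finset.single_le_sum (f := fun l => ‖σ (X.H k l)‖) (fun _ _ => norm_nonneg _) (Finset.mem_univ l)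
    _ ≤ ∑ k, ∑ l, ‖σ (X.H k l)‖ :=
        Finset.single_le_sum (f := fun k => ∑ l, ‖σ (X.H k l)‖) (fun _ _ => Finset.sum_nonneg fun _ _ => norm_nonneg _)
          (Finset.mem_univ k)

end T4Data

end Summit.Ventures.HodgeRepro.Tier4.Line3

end
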